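import Mathlib
import Summits.MatrixMultiplication.MatrixMultiplication.Theses.MatrixPointInterpolation
import Summits.MatrixMultiplication.MatrixMultiplication.Theorems.MatrixPointInterpolationWindowedKaplanskyCapelli

/-!
# `MatrixPointInterpolation.WindowedKaplansky` (stmt-MatrixMultiplication-18945) — helper file 3:
# the point size `k = 2` through the algebraicity dichotomy, with the bound `n ≤ 3`

A short second proof of the windowed Kaplansky theorem at `k = 2`, as the first instance of the
`k`-uniform machinery of `…WindowedKaplanskyCapelli`: if `A` masquerades as `M₂` to degree `2d`
with `d ≥ 4` and generates `M_n` in degree `d`, the dichotomy at `K = 1` says that every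
`Y ∈ V_1 = span{1, A 0, A 1}` either has `1, Y, Y²` linearly dependent or commutes with `A 0, A 1`
(the order-`1` Cayley–Hamilton–Capelli polynomial is the commutator, `capPow_one`), hence is
scalar; so every element of `V_1` is quadratic (`mul_self_mem_wordSpan_one`), anticommutators of
`V_1` lie in `V_1`, every word of length `3` reduces to length `≤ 2` (`wordSpan_three_le_two`),
`M_n = V_d = V_2` has dimension `≤ 7`, and `n ≤ 2`.  Since `n ≥ 4` forces `d ≥ 4` by counting
words, **no masquerade of `M₂` has `n ≥ 4`** (`no_masquerade_two_of_four_le`; the tree's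
`LongMasqueradeNeg.no_masquerade_two` needs `n ≥ 6`).
-/

namespace Summit.MatrixMultiplication.MatrixMultiplication.Theorems

namespace Masquerade

open Equiv

/-- The order-one Cayley–Hamilton–Capelli polynomial is the commutator:
`P_1(y; z) = z y - y z`. [folklore] -/
theorem capPow_one {R : Type*} [Ring R] (y : R) (z : Fin 1 → R) :
    capPow 1 y z = z 0 * y - y * z 0 := by
  rw [← Fin.cons_self_tail z, capPow_succ_cons, Fin.sum_univ_two]
  simp only [capRest, sum_filter_apply_zero_eq, capTail, Fin.cons_zero]
  simp [swap_apply_right, sub_eq_add_neg]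

section two

variable {n d : ℕ} {A : Fin 2 → Matrix (Fin n) (Fin n) ℂ}

/-- `k = 2`, `d ≥ 4`: every `Y ∈ V_1` has `1, Y, Y²` linearly dependent. [folklore] -/
theorem not_linearIndependent_pow_of_mem_wordSpan_one (hd : 4 ≤ d)
    (hspan : Submodule.span ℂ {M : Matrix (Fin n) (Fin n) ℂ |
      ∃ w : List (Fin 2), w.length ≤ d ∧ (w.map A).prod = M} = ⊤)
    (hmasq : ∀ (T : Finset (List (Fin 2))) (c : List (Fin 2) → ℂ), (∀ w ∈ T, w.length ≤ 2 * d) →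
      (∀ B : Fin 2 → Matrix (Fin 2) (Fin 2) ℂ, (∑ w ∈ T, c w • (w.map B).prod) = 0) →
      (∑ w ∈ T, c w • (w.map A).prod) = 0)
    {Y : Matrix (Fin n) (Fin n) ℂ} (hY : Y ∈ wordSpan A 1) :
    ¬ LinearIndependent ℂ (fun j : Fin 3 => Y ^ (j : ℕ)) := by
  rcases capPow_dichotomy (K := 1) hspan hmasq (L := 1) (e := 1) (by norm_num; omega) hY with h | h
  · exact h
  · -- `Y` commutes with both generators, hence is scalar, hence `1, Y` are dependent
    have hcomm : ∀ i, Y * A i = A i * Y := by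
      intro i
      have := h (fun _ => A i) fun _ => gen_mem_wordSpan A le_rfl i
      rw [capPow_one] at this
      exact (sub_eq_zero.1 this).symm
    obtain ⟨s, hs⟩ := LongMasqueradeNeg.scalar_of_commute_gens hspan hcomm
    rw [Fintype.not_linearIndependent_iff]
    refine ⟨![-s, 1, 0], ?_, ⟨1, by simp⟩⟩
    simp [Fin.sum_univ_three, hs]

/-- `k = 2`, `d ≥ 4`: every element of `V_1` is quadratic, `Y² ∈ V_1`. [folklore] -/
theorem mul_self_mem_wordSpan_one (hd : 4 ≤ d)
    (hspan : Submodule.span ℂ {M : Matrix (Fin n) (Fin n) ℂ |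
      ∃ w : List (Fin 2), w.length ≤ d ∧ (w.map A).prod = M} = ⊤)
    (hmasq : ∀ (T : Finset (List (Fin 2))) (c : List (Fin 2) → ℂ), (∀ w ∈ T, w.length ≤ 2 * d) →
      (∀ B : Fin 2 → Matrix (Fin 2) (Fin 2) ℂ, (∑ w ∈ T, c w • (w.map B).prod) = 0) →
      (∑ w ∈ T, c w • (w.map A).prod) = 0)
    {Y : Matrix (Fin n) (Fin n) ℂ} (hY : Y ∈ wordSpan A 1) : Y * Y ∈ wordSpan A 1 := by
  obtain ⟨g, hg, j, hj⟩ := Fintype.not_linearIndependent_iff.1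
    (not_linearIndependent_pow_of_mem_wordSpan_one hd hspan hmasq hY)
  simp only [Fin.sum_univ_three, Fin.val_zero, pow_zero, Fin.val_one, pow_one, Fin.val_two] at hg
  have h1 : (1 : Matrix (Fin n) (Fin n) ℂ) ∈ wordSpan A 1 := one_mem_wordSpan A 1
  by_cases h2 : g 2 = 0
  · by_cases h1' : g 1 = 0
    · have h0 : g 0 ≠ 0 := by
        fin_cases j
        · exact hj
        · exact absurd h1' hj
        · exact absurd h2 hj
      rw [h2, h1', zero_smul, zero_smul, add_zero, add_zero, smul_eq_zero] at hg
      rcases hg with hg | hg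
      · exact absurd hg h0
      · -- `1 = 0`: the zero ring
        have : Y * Y = 0 := by rw [← one_mul (Y * Y), hg, zero_mul]
        rw [this]
        exact Submodule.zero_mem _
    · -- `Y` is scalar
      rw [h2, zero_smul, add_zero] at hg
      have hY1 : g 1 • Y = (-g 0) • (1 : Matrix (Fin n) (Fin n) ℂ) := by
        rw [neg_smul, eq_neg_iff_add_eq_zero, add_comm]
        exact hg
      have hYs : Y = ((g 1)⁻¹ * -g 0) • (1 : Matrix (Fin n) (Fin n) ℂ) := by
        rw [mul_smul, ← hY1, inv_smul_smul₀ h1']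
      rw [hYs, smul_mul_smul, one_mul]
      exact Submodule.smul_mem _ _ h1
  · have : Y * Y = (-(g 2)⁻¹ * g 0) • (1 : Matrix (Fin n) (Fin n) ℂ) + (-(g 2)⁻¹ * g 1) • Y := by
      have hsq : Y ^ 2 = (g 2)⁻¹ • (-(g 0 • (1 : Matrix (Fin n) (Fin n) ℂ) + g 1 • Y)) := by
        rw [← inv_smul_smul₀ h2 (Y ^ 2)]
        congr 1
        rw [eq_neg_iff_add_eq_zero, ← hg]
        abel
      rw [← sq, hsq, smul_neg, smul_add, smul_smul, smul_smul, neg_add, ← neg_smul, ← neg_smul,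
        neg_mul, neg_mul]
    rw [this]
    exact Submodule.add_mem _ (Submodule.smul_mem _ _ h1) (Submodule.smul_mem _ _ hY)

/-- `k = 2`, `d ≥ 4`: anticommutators of `V_1` lie in `V_1` (polarisation). [folklore] -/
theorem anticomm_mem_wordSpan_one (hd : 4 ≤ d)
    (hspan : Submodule.span ℂ {M : Matrix (Fin n) (Fin n) ℂ |
      ∃ w : List (Fin 2), w.length ≤ d ∧ (w.map A).prod = M} = ⊤)
    (hmasq : ∀ (T : Finset (List (Fin 2))) (c : List (Fin 2) → ℂ), (∀ w ∈ T, w.length ≤ 2 * d) →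
      (∀ B : Fin 2 → Matrix (Fin 2) (Fin 2) ℂ, (∑ w ∈ T, c w • (w.map B).prod) = 0) →
      (∑ w ∈ T, c w • (w.map A).prod) = 0)
    {Y Y' : Matrix (Fin n) (Fin n) ℂ} (hY : Y ∈ wordSpan A 1) (hY' : Y' ∈ wordSpan A 1) :
    Y * Y' + Y' * Y ∈ wordSpan A 1 := by
  have h := mul_self_mem_wordSpan_one hd hspan hmasq (Submodule.add_mem _ hY hY')
  have e : Y * Y' + Y' * Y = (Y + Y') * (Y + Y') - Y * Y - Y' * Y' := by noncomm_ring
  rw [e]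
  exact Submodule.sub_mem _ (Submodule.sub_mem _ h (mul_self_mem_wordSpan_one hd hspan hmasq hY))
    (mul_self_mem_wordSpan_one hd hspan hmasq hY')

/-- `k = 2`, `d ≥ 4`: every word of length `3` reduces, `V_3 ≤ V_2`. [folklore] -/
theorem wordSpan_three_le_two (hd : 4 ≤ d)
    (hspan : Submodule.span ℂ {M : Matrix (Fin n) (Fin n) ℂ |
      ∃ w : List (Fin 2), w.length ≤ d ∧ (w.map A).prod = M} = ⊤)
    (hmasq : ∀ (T : Finset (List (Fin 2))) (c : List (Fin 2) → ℂ), (∀ w ∈ T, w.length ≤ 2 * d) →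
      (∀ B : Fin 2 → Matrix (Fin 2) (Fin 2) ℂ, (∑ w ∈ T, c w • (w.map B).prod) = 0) →
      (∑ w ∈ T, c w • (w.map A).prod) = 0) :
    wordSpan A 3 ≤ wordSpan A 2 := by
  have hg : ∀ x, A x ∈ wordSpan A 1 := gen_mem_wordSpan A le_rfl
  have h11 : ∀ {M N}, M ∈ wordSpan A 1 → N ∈ wordSpan A 1 → M * N ∈ wordSpan A 2 :=
    fun hM hN => by simpa using mul_mem_wordSpan hM hN
  refine Submodule.span_le.2 ?_
  rintro M ⟨w, hw, rfl⟩
  rcases Nat.lt_or_ge w.length 3 with hlt | hge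
  · exact wordSpan_mono A (show w.length ≤ 2 by omega) (prod_mem_wordSpan A w le_rfl)
  · -- a word of length exactly three
    obtain ⟨x, y, z, rfl⟩ : ∃ x y z, w = [x, y, z] := List.length_eq_three.1 (by omega)
    simp only [List.map_cons, List.map_nil, List.prod_cons, List.prod_nil, mul_one,
      SetLike.mem_coe]
    by_cases hxy : x = y
    · subst hxy
      rw [← mul_assoc]
      exact h11 (mul_self_mem_wordSpan_one hd hspan hmasq (hg x)) (hg z)
    by_cases hyz : y = z
    · subst hyz
      exact h11 (hg x) (mul_self_mem_wordSpan_one hd hspan hmasq (hg y))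
    · have hxz : z = x := by
        apply Fin.ext
        have := Fin.val_ne_of_ne hxy
        have := Fin.val_ne_of_ne hyz
        omega
      subst hxz
      have e : A z * (A y * A z) = A z * (A y * A z + A z * A y) - A z * A z * A y := by
        noncomm_ring
      rw [e]
      exact Submodule.sub_mem _ (h11 (hg z) (anticomm_mem_wordSpan_one hd hspan hmasq (hg y) (hg z)))
        (h11 (mul_self_mem_wordSpan_one hd hspan hmasq (hg z)) (hg y))

/-- `k = 2`, `d ≥ 4`: the whole filtration collapses, `V_L ≤ V_2` for every `L`. [folklore] -/
theorem wordSpan_le_two (hd : 4 ≤ d)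
    (hspan : Submodule.span ℂ {M : Matrix (Fin n) (Fin n) ℂ |
      ∃ w : List (Fin 2), w.length ≤ d ∧ (w.map A).prod = M} = ⊤)
    (hmasq : ∀ (T : Finset (List (Fin 2))) (c : List (Fin 2) → ℂ), (∀ w ∈ T, w.length ≤ 2 * d) →
      (∀ B : Fin 2 → Matrix (Fin 2) (Fin 2) ℂ, (∑ w ∈ T, c w • (w.map B).prod) = 0) →
      (∑ w ∈ T, c w • (w.map A).prod) = 0) (L : ℕ) :
    wordSpan A L ≤ wordSpan A 2 := by
  refine wordSpan_le_of_mul_mem A _ (one_mem_wordSpan A 2) (fun x M hM => ?_) L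
  have h3 : A x * M ∈ wordSpan A 3 := by simpa using mul_mem_wordSpan (gen_mem_wordSpan A le_rfl x) hM
  exact wordSpan_three_le_two hd hspan hmasq h3

/-- **Windowed Kaplansky at `k = 2`, sharp form of the size bound: no masquerade of `M₂(ℂ)` has
`n ≥ 4`.** (For `n ≥ 4` the word count forces `d ≥ 4`; then `M_n = V_d ≤ V_2` has dimension
`≤ 7 < 16`.) [folklore] -/
theorem no_masquerade_two_of_four_le (hn : 4 ≤ n)
    (hspan : Submodule.span ℂ {M : Matrix (Fin n) (Fin n) ℂ |
      ∃ w : List (Fin 2), w.length ≤ d ∧ (w.map A).prod = M} = ⊤)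
    (hmasq : ∀ (T : Finset (List (Fin 2))) (c : List (Fin 2) → ℂ), (∀ w ∈ T, w.length ≤ 2 * d) →
      (∀ B : Fin 2 → Matrix (Fin 2) (Fin 2) ℂ, (∑ w ∈ T, c w • (w.map B).prod) = 0) →
      (∑ w ∈ T, c w • (w.map A).prod) = 0) : False := by
  have hcount := sq_le_of_wordSpan_eq_top (A := A) hspan
  have hd : 4 ≤ d := by
    by_contra hd
    have h2 : 2 ^ (d + 1) ≤ 2 ^ 4 := Nat.pow_le_pow_right (by norm_num) (by omega)
    have h15 : 2 ^ (d + 1) - 1 ≤ 15 := Nat.sub_le_of_le_add (by simpa using h2)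
    have h16 : 4 ^ 2 ≤ n ^ 2 := Nat.pow_le_pow_left hn 2
    have := hcount.trans h15
    omega
  have htop : (⊤ : Submodule ℂ (Matrix (Fin n) (Fin n) ℂ)) ≤ wordSpan A 2 := by
    rw [← show wordSpan A d = ⊤ from hspan]
    exact wordSpan_le_two hd hspan hmasq d
  have h1 : Module.finrank ℂ (Matrix (Fin n) (Fin n) ℂ) ≤ Module.finrank ℂ (wordSpan A 2) := by
    rw [← finrank_top]
    exact Submodule.finrank_mono htop
  have h2 := finrank_wordSpan_le A 2
  rw [Module.finrank_matrix, Fintype.card_fin, Module.finrank_self, mul_one] at h1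
  norm_num at h2
  nlinarith

end two

end Masquerade

end Summit.MatrixMultiplication.MatrixMultiplication.Theorems
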